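import Summits.BirchSwinnertonDyer.Rank1Residual.X5.TwoAdicTargetsMultKatoInt
import Summits.BirchSwinnertonDyer.Rank1Residual.X5.TwoAdicTargetsSplitGS
import HarnessLib

/-!
# Class O1 (X5, `p = 2`, non-CM), SPLIT MULTIPLICATIVE `2`, E[2] IRREDUCIBLE: Kato's divisibility
# WITH the 2-power part AWAY FROM THE TRIVIAL ZERO (T-KATO2-SPMULT) as a DISPLAYED hypothesis, and
# door (34-INT-pinch-split) — the UPPER HALF with no certificate, and `BSD₂(E)` by the Selmer `λ`-pinch

HONEST FRAMING (cell `bsd-2adic`, run/shared/lean/pub/bsd-2adic/, seat `bsd-2adic-mult` GEN 7; HUMAN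
RULINGS D-0036 / D-0054): research route; nothing is asserted; no class is closed here; no count moves.
ONE displayed `def` — `O1.KatoDivisibilityAtTwoSplitMultInt` = THEOREM B of
`HOME/mult/PROOF-KATO2MULT.md` made UNCONDITIONAL in `HOME/mult/PROOF-KATO2SPLIT.md` (GEN 7, referee
pending): for `ρ_{E,2^∞}` surjective and `E` SPLIT multiplicative at `2`, `X(E/ℚ_∞)` is `Λ`-torsion and
`T · char_Λ X(E/ℚ_∞) ∣ L₂(E,T)` in `Λ = ℤ₂⟦T⟧` — `2`-power part INCLUDED, the trivial zero of `L₂`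
divided out on the analytic side (the tree's K11b-Rat `O1.KatoDivisibilityAtTwoSplitMultRat` with the
slack `2ⁿ` replaced by the period ratio `ϖ`, i.e. `n = 0` in the Néron normalisation on the `Δ < 0`
locus). The memo's new inputs over Theorem A (non-split, GEN 6) are LOCAL CLASS FIELD THEORY ONLY:
(Lemma N) the corestriction `N_Δ` from Kato's tower `ℚ₂(ζ_{2^∞})` to the cyclotomic `ℤ₂`-tower of `ℚ₂`
is SURJECTIVE on `lim Hom(G, ℤ₂)` (the finite-level obstruction is `ℤ/2`, generated by the valuation,
and dies one layer up because the uniformiser `2 − ζ − ζ⁻¹` of `ℚ₂(ζ_{2^{n+2}})⁺` is a square in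
`ℚ₂(ζ_{2^{n+3}})⁺`), which removes the obstruction (S-ii) of PROOF-KATO2MULT-ADDENDUM-1 A1.3(b);
(Lemma S) integrality of the descended regulator, from Kato's own Coleman-power-series sentence
(Astérisque 295, proof of Lemma 17.12, p. 278) read on the norm-coherent UNITS — where it does not
use `H⁰(ℚ₂, T″) = 0` — plus the valuation-quotient trick of A1.3(a)(3). THREE PROVED doors:
`missingUpperBoundAt_two_split_of_katoInt` (the UPPER HALF `ord₂ #Ш ≤ ord₂ #Ш_an`, item
`MultUpperHalfAtTwo`, with NO certificate: PRINT {A236 `h41`, modularity, GZK} + the tree's named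
fact `greenberg_stevens W 2` (memo PROOF-GS2, RC-4 PASS) + MEMO {`hKint`}), `bsdp_two_split_of_katoIntPinch`
(`BSDp W 2`, both halves: + MEMO {`hlow`} + CERTIFICATES {`hlan : λ_an = n + 1`, `hμan : μ_an = 0`},
GEN-3 engine) and the rank-`0` `2`-converse `analyticRank_eq_zero_of_finite_selmer_of_katoIntSplitPinch`.
NO period datum is needed (the integral `g` carries it), no reference curve, no rational `2`-torsion
point, no λ-law, no `μ`-hypothesis on `X`. The split twin of `X5/TwoAdicTargetsMultKatoInt.lean` (GEN 6).
CENSUS-6 (kit j248824): split ∧ `E[2]` irreducible 590 classes, surjective 566 (565 of rank 0),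
`Δ < 0` 437 (436 of rank 0, ALL with `dim_𝔽₂ Sel₂(E/ℚ) = 2`), `Δ > 0` 129.

PARTITION (D-0054): X5@2 mult, E[2]-irreducible SPLIT (B1·O1; 566 surjective split of 1 976 book230
classes) × p = 2 — types-the-object-of (door); closes none.
References: [Kato2004Asterisque] 16.4, 16.6, 17.11–17.13 (Lemma 17.12 p. 278); [Rubin2000EulerSystems]
Thm. II.3.8; [GreenbergLNM1716] Prop. 4.14 (p. 124), §4 pp. 112–113 (split `l_v`) and §3 p. 94;
[GreenbergVatsal2000] p. 4; [MazurTateTeitelbaum1986Invent] §I.10, §I.14–15, §II; [Miller2011LMS]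
Def. 1.1; [Cesnavicius2018] Thm. 1.2; [BarreSirieixDiazGramainPhilibert1996Manin] (𝓛₂ ≠ 0).
-/

set_option autoImplicit false

noncomputable section

open scoped Classical MatrixGroups ModularForm

open CongruenceSubgroup WeierstrassCurve Literature.NumberTheory.EllipticCurves
  Literature.NumberTheory.EllipticCurves.ModularForms
  Literature.NumberTheory.EllipticCurves.Wuthrich2014
  Literature.NumberTheory.EllipticCurves.Rank1Residual
  Literature.NumberTheory.EllipticCurves.Rank1Residual.Typed
  Literature.NumberTheory.EllipticCurves.Greenberg1999
  Literature.NumberTheory.Transcendental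
  Summit.BirchSwinnertonDyer.Rank1Residual.X1.MuLambda
  Summit.BirchSwinnertonDyer.Rank1Residual.X1.MuPart
  Summit.BirchSwinnertonDyer.Rank1Residual.X1.ParitySqueeze

namespace Summit.BirchSwinnertonDyer.Rank1Residual.X5.O1

variable (W : WeierstrassCurve ℚ) [W.IsElliptic] [W.IsGloballyMinimal]

/-! ## §1 T-KATO2-SPMULT as a DISPLAYED hypothesis (nothing asserted) -/

/-- **T-KATO2-SPMULT (DISPLAYED; memo-proved in `HOME/mult/PROOF-KATO2SPLIT.md` v1 Thm. B + §4.7,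
referee pending; nothing asserted).** For `W` (globally minimal) SPLIT multiplicative at `2` with
`ρ_{E,2^∞}(G_ℚ) = GL₂(ℤ₂)` (`TwoAdicSurjective`) and `Δ_W < 0` (one real component, so that the least
positive real period IS the BSD period): for every newform `f` of `W`, THE split `2`-adic `L`-function `L`
of `f` (`α = a₂ = +1`, `L(0) = 0`), every cyclotomic `ℤ₂`-extension with a matching generator, every
dual datum `D` of `Sel_{2^∞}(E/ℚ_∞)` and every period ratio `ϖ` (`ϖ·Ω_E = Ω⁺_f`): `X` is torsion and
there is `g ∈ char_Λ X` with `ι(T·g) = ϖ·L` — i.e. `T · char_Λ X ∣ ϖ·L` in `Λ = ℤ₂⟦T⟧`, `2`-POWER PART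
INCLUDED, the trivial zero divided out on the ANALYTIC side (the memo's Thm. B: `L₂^{Ω⁺_E} ∈ TΛ`,
`T·char X ∣ L₂^{Ω⁺_E}`; and `L₂^{Ω⁺_E} = ϖ·c_∞·L` with `c_∞ = 1` here, the unit absorbed into `g`).
This is K11b-Rat `KatoDivisibilityAtTwoSplitMultRat W f L` with `2ⁿ ↦ ϖ` (`ϖ ∈ ℤ₍₂₎ˣ` on this locus
by Česnavičius 2018 Thm. 1.2 and odd isogenies, memo §4.7 — so `n = 0`). In print only `⊗ℚ` / for odd
`p` (Kato Thm. 17.4 assumes `p ∤ N`; Kobayashi 2006 Thm. 4.1 and Wuthrich 2014 Thm. 16 / Cor. 19: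
`p` odd; Skinner 2016 `p ≥ 3`). New inputs over the non-split twin: local class field theory in the
tower `ℚ₂(ζ_{2^∞}) ⊃ ∪ₙ ℚ₂(ζ_{2^{n+2}})⁺` (memo Lemma N) and Kato's Coleman sentence on units
(Lemma 17.12's proof, p. 278; memo Lemma S). [cite: Kato2004Asterisque, Lemma 17.12 proof (p. 278), Prop. 17.11, 17.13 (pp. 277–280), Thm. 16.4/16.6 (pp. 270–271)]
[cite: Wuthrich2014, Thm. 16 and Cor. 19 (odd p; shape)] [cite: Kobayashi2006DocMath, Thm. 4.1 (odd p; shape)] -/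
@[conjecture] def KatoDivisibilityAtTwoSplitMultInt : Prop :=
  Mult W 2 → W.HasSplitMultiplicativeReductionAtPrime 2 → TwoAdicSurjective W → W.Δ < 0 →
  ∀ ⦃N : ℕ⦄ [NeZero N] (f : CuspForm (Gamma0 N) 2), IsNewformOf W f →
  ∀ (L : PowerSeries ℚ_[2]), IsSplitMultPAdicLFunctionOf f 2 L →
  ∀ (κ : ZpExtension ℚ 2) (γ : Field.absoluteGaloisGroup ℚ),
    κ.IsCyclotomic → κ.IsTopGenerator γ → IsCyclotomicVariable 2 γ →
  ∀ (D : W.SelmerDualData κ γ) (ϖ : ℚ), (ϖ : ℝ) * W.realPeriodRat = plusPeriod f →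
    D.IsTorsion ∧ ∃ g ∈ D.charIdeal,
      iwasawaToPowerSeries 2 (PowerSeries.X * g) = PowerSeries.C (ϖ : ℚ_[2]) * L

omit [W.IsElliptic] [W.IsGloballyMinimal] in
/-- Off the multiplicative locus the displayed statement holds VACUOUSLY (its guard). [folklore] -/
theorem katoDivisibilityAtTwoSplitMultInt_of_not_mult (h : ¬ Mult W 2) :
    KatoDivisibilityAtTwoSplitMultInt W :=
  fun hm => absurd hm h

omit [W.IsElliptic] [W.IsGloballyMinimal] in
/-- At a NON-SPLIT `2` the displayed statement holds VACUOUSLY (its guard). [folklore] -/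
theorem katoDivisibilityAtTwoSplitMultInt_of_not_split
    (h : ¬ W.HasSplitMultiplicativeReductionAtPrime 2) : KatoDivisibilityAtTwoSplitMultInt W :=
  fun _ hsp => absurd hsp h

/-! ## §2 The Selmer `λ`-pinch at a SPLIT `2` from the INTEGRAL divisibility (pure algebra) -/

/-- **The `λ`-pinch from T-KATO2-SPMULT (PROVED, pure algebra).** A cyclotomic dual datum `D` with `X`
torsion and `g ∈ char_Λ X = (f_X)` with `ι(T·g) = ϖ·L` (T-KATO2-SPMULT), certificates `μ = 0` (`hμan`)
and `λ = n + 1` (`hlan`) for the INTEGRAL normalisation `T·g` of `ϖ·L` (the trivial zero of `L` is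
the factor `T`: `λ(T) = 1`, `μ(T) = 0`, so `λ(g) = n`, `μ(g) = 0`), and the Selmer lower bound
`n ≤ λ(X)` once `μ(X) = 0` (`hlow`, `O1.SelmerLambdaLowerBoundAtTwo W n`: `n = dim_𝔽₂ Sel₂(E/ℚ)`).
Then `char_Λ X = (g)`: `g = f_X·b` gives `μ(f_X) ≤ μ(g) = 0`, so `μ(X) = 0`, so
`λ(g) = n ≤ λ(X) = λ(f_X)`, and `span_eq_span_iff_mu_le_and_lam_le` closes. No `μ`-hypothesis on `X`,
no reference curve, no rank input, no period datum. Split twin of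
`charIdeal_eq_span_of_katoInt_selmerPinch_nonsplit`. [cite: GreenbergVatsal2000, p. 4 (after Thm. (1.2)) (λ_alg = λ_an and μ_alg = μ_an ⇒ main conjecture)]
[cite: MazurTateTeitelbaum1986Invent, §I.15 (L(0) = 0 at a split prime)] -/
theorem charIdeal_eq_span_of_katoIntSplit_selmerPinch
    (hsp : W.HasSplitMultiplicativeReductionAtPrime 2) {n : ℕ}
    (hlan : X2.AnalyticLambdaEq W 2 (n + 1)) (hμan : X2.AnalyticMuLE W 2 0)
    {κ : ZpExtension ℚ 2} {γ : Field.absoluteGaloisGroup ℚ} (hκ : κ.IsCyclotomic)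
    (hγ : κ.IsTopGenerator γ) (hγ' : IsCyclotomicVariable 2 γ)
    {N : ℕ} [NeZero N] {f : CuspForm (Gamma0 N) 2} (hf : IsNewformOf W f) {L : PowerSeries ℚ_[2]}
    (hLf : IsSplitMultPAdicLFunctionOf f 2 L) (D : W.SelmerDualData κ γ) (hX : D.IsTorsion)
    {ϖ : ℚ} (hϖ : (ϖ : ℝ) * W.realPeriodRat = plusPeriod f) {g : IwasawaAlgebra 2}
    (hι : iwasawaToPowerSeries 2 (PowerSeries.X * g) = PowerSeries.C (ϖ : ℚ_[2]) * L)
    (hg : g ∈ D.charIdeal) (hlow : SelmerLambdaLowerBoundAtTwo W n) :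
    D.charIdeal = Ideal.span {g} := by
  haveI : Module.Finite (IwasawaAlgebra 2) D.X := D.module_finite_holds hγ
  obtain ⟨k, hk⟩ := hμan f hf ϖ hϖ L (fun _ => hLf) (fun hns => absurd hsp hns)
  rw [← hι] at hk
  have hμL₀ : mu (PowerSeries.X * g : IwasawaAlgebra 2) = 0 :=
    Nat.le_zero.mp (mu_le_of_lt_norm_coeff hk)
  have hL₀0 : (PowerSeries.X * g : IwasawaAlgebra 2) ≠ 0 := by
    intro h0
    rw [h0, map_zero, map_zero, norm_zero] at hk
    exact not_le.mpr hk (by positivity)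
  have hX0 : (PowerSeries.X : IwasawaAlgebra 2) ≠ 0 := PowerSeries.X_ne_zero
  have hg0 : g ≠ 0 := by
    rintro rfl
    exact hL₀0 (mul_zero _)
  have hlan' : lam (PowerSeries.X * g : IwasawaAlgebra 2) = n + 1 :=
    hlan f hf ϖ hϖ L (fun _ => hLf) (fun hns => absurd hsp hns) _ hι
  have hlamg : lam g = n := by
    rw [lam_mul hX0 hg0, X2.lam_X] at hlan'
    omega
  have hμg : mu g = 0 := by
    rw [mu_mul hX0 hg0, X2.mu_X_eq_zero_and_pfree_X.1] at hμL₀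
    omega
  haveI : (Module.charIdeal (IwasawaAlgebra 2) D.X).IsPrincipal := charIdeal_isPrincipal_holds 2 D.X
  obtain ⟨fX, hfX⟩ := Submodule.IsPrincipal.principal (Module.charIdeal (IwasawaAlgebra 2) D.X)
  have hchar : D.charIdeal = Ideal.span {fX} := hfX
  have hfX0 : fX ≠ 0 := by
    intro h0
    refine Module.charIdeal_ne_bot (IwasawaAlgebra 2) D.X ?_
    change D.charIdeal = ⊥
    rw [hchar, h0]
    exact Ideal.span_singleton_eq_bot.mpr rfl
  rw [hchar] at hg
  obtain ⟨b, hb⟩ := Ideal.mem_span_singleton'.mp hg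
  have hfac : g = fX * b := by rw [mul_comm, hb]
  have hb0 : b ≠ 0 := by rintro rfl; exact hg0 (by rw [hfac, mul_zero])
  have hμfX : mu fX = 0 := by
    have h := mu_le_mu_mul hfX0 hb0
    rw [← hfac, hμg] at h
    exact Nat.le_zero.mp h
  have hμX : D.mu = 0 := by
    rw [SelmerDualData.mu, ← mu_generator_eq_muInvariant D.X hX hfX0 hchar]; exact hμfX
  have hlamfX : lam fX = D.lambda := lam_generator_eq_lambdaInvariant D.X hX hfX0 hchar
  have hle : n ≤ D.lambda := hlow κ γ hκ hγ hγ' D hX hμX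
  have hspan : Ideal.span ({g} : Set (IwasawaAlgebra 2)) = Ideal.span {fX} :=
    (span_eq_span_iff_mu_le_and_lam_le hfX0 hg0 hfac).mpr
      ⟨by rw [hμg]; exact Nat.zero_le _, by rw [hlamg, hlamfX]; exact hle⟩
  rw [hchar, hspan]

/-! ## §3 Door (34-INT-pinch-split), SPLIT `2`, E[2] irreducible: `BSD₂(E)` and the rank-`0` `2`-converse -/

/-- **DOOR (34-INT-pinch-split), split `E` with `E[2]` irreducible (PROVED modulo the displayed inputs):
`BSDp W 2`, both halves.** Binders: PRINT {A236 `h41` (Greenberg's split analogue of Thm. 4.1 at `2`,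
`l_v = 𝓛₂(E)/4`, audit V3 PASS), modularity `hmod`, GZK}; the tree's named fact `greenberg_stevens W 2`
(`hGS`; memo PROOF-GS2, referee RC-4 PASS); MEMO {T-KATO2-SPMULT `hKint` (PROOF-KATO2SPLIT Thm. B),
the Selmer `λ`-lower-bound `hlow` (PROOF-KATO2MULT §6.2 on Greenberg 4.14)}; CERTIFICATES
{`λ_an(E) = n + 1` (`hlan`, the `+1` is the trivial zero), `μ_an(E) = 0` (`hμan`) — GEN-3 engine at
level 6}; the curve's own decidable data {`Mult W 2`, split, `TwoAdicSurjective W`, `Δ < 0`}; analytic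
rank `0`. NO period datum (`g` is integral by `hKint`), no reference, no `2`-torsion point, no `μ`-input.
Chain: `hKint` ⇒ `X` torsion ∧ `g ∈ char X`, `ι(T·g) = ϖ·L`;
`charIdeal_eq_span_of_katoIntSplit_selmerPinch` ⇒ `char X = (g)`;
`missingPPartAt_two_split_of_charIdeal_eq_span` (A236: `l_v = 𝓛₂/4`; Greenberg–Stevens:
`[T¹]L·log₂ γ = 𝓛₂·[0]⁺_f`; `ord₂ log₂ 5 = 2`; the `𝓛₂ ≠ 0` cancel) ⇒ `ord₂ #Ш_an = ord₂ #Ш`;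
`bsdp_of_missingPPartAt`. [cite: GreenbergLNM1716, §4 pp. 112–113 (split l_v), §3 p. 94 and Prop. 4.14 (p. 124)]
[cite: MazurTateTeitelbaum1986Invent, §I.14–15 and §II (exceptional zero, 𝓛_p = log_p q/ord_p q)]
[cite: Miller2011LMS, Def. 1.1 and §1] -/
theorem bsdp_two_split_of_katoIntPinch {n : ℕ}
    (h41 : thm41Analogue_charValue_rankZero_split_baseChange_anyPrime)
    (hGS : greenberg_stevens (W := W) (p := 2))
    (hmod : nonempty_modularParametrizationData)
    (hGZK : rank_eq_analyticRank_of_analyticRank_le_one)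
    (hKint : KatoDivisibilityAtTwoSplitMultInt W) (hlow : SelmerLambdaLowerBoundAtTwo W n)
    (hr : W.analyticRank = 0) (hmult : Mult W 2) (hsp : W.HasSplitMultiplicativeReductionAtPrime 2)
    (him : TwoAdicSurjective W) (hΔ : W.Δ < 0)
    (hlan : X2.AnalyticLambdaEq W 2 (n + 1)) (hμan : X2.AnalyticMuLE W 2 0) : BSDp W 2 := by
  haveI : NeZero (W.conductorNorm ℤ) := ⟨(W.conductorNorm_pos_holds).ne'⟩
  obtain ⟨Dm⟩ := hmod W
  have hf : IsNewformOf W Dm.f := Dm.isNewformOf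
  have hL : W.entireLFunction 1 ≠ 0 :=
    (W.analyticRank_eq_zero_iff_holds hf.hasEntireLFunction).mp hr
  obtain ⟨ϖ, -, hϖ, -⟩ := Dm.exists_rat_mul_realPeriodRat_eq_plusPeriod
  obtain ⟨κ, hκ, γ, hγ, hγ'⟩ := exists_isCyclotomic_isTopGenerator_isCyclotomicVariable_holds 2
  obtain ⟨DW⟩ := W.nonempty_selmerDualData_holds κ γ hγ
  obtain ⟨L, hLf⟩ := exists_isSplitMultPAdicLFunctionOf hsp hf
  obtain ⟨hX, g, hg, hι⟩ := hKint hmult hsp him hΔ Dm.f hf L hLf κ γ hκ hγ hγ' DW ϖ hϖ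
  have hchar := charIdeal_eq_span_of_katoIntSplit_selmerPinch W hsp hlan hμan hκ hγ hγ' hf hLf DW hX
    hϖ hι hg hlow
  exact bsdp_of_missingPPartAt W 2 hGZK (by rw [hr]; exact zero_le_one)
    (missingPPartAt_two_split_of_charIdeal_eq_span W
      (twoAdicEulerCharRankZeroSplitMult_zero_of_greenberg W h41) hGS hGZK hmult hsp hL hκ hγ hγ' hf
      hLf DW hX hϖ hι hchar)

/-- **DOOR (34-INT-pinch-split), split `E` with `E[2]` irreducible, CONVERSE FORM (PROVED modulo the
displayed inputs):** with the same inputs MINUS analytic rank `0` and GZK, `Sel_{2^∞}(E/ℚ)` finite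
⇒ `L(E,1) ≠ 0 ∧ r_an(E) = 0`. [cite: GreenbergLNM1716, §4 pp. 112–113 and Prop. 4.14 (p. 124)]
[cite: MazurTateTeitelbaum1986Invent, §I.14–15 and §II] -/
theorem analyticRank_eq_zero_of_finite_selmer_of_katoIntSplitPinch {n : ℕ}
    (h41 : thm41Analogue_charValue_rankZero_split_baseChange_anyPrime)
    (hGS : greenberg_stevens (W := W) (p := 2))
    (hmod : nonempty_modularParametrizationData)
    (hKint : KatoDivisibilityAtTwoSplitMultInt W) (hlow : SelmerLambdaLowerBoundAtTwo W n)
    (hmult : Mult W 2) (hsp : W.HasSplitMultiplicativeReductionAtPrime 2)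
    (him : TwoAdicSurjective W) (hΔ : W.Δ < 0)
    (hlan : X2.AnalyticLambdaEq W 2 (n + 1)) (hμan : X2.AnalyticMuLE W 2 0)
    (hfin : Finite (W.selmerGroupPInfty 2)) : W.entireLFunction 1 ≠ 0 ∧ W.analyticRank = 0 := by
  haveI : NeZero (W.conductorNorm ℤ) := ⟨(W.conductorNorm_pos_holds).ne'⟩
  obtain ⟨Dm⟩ := hmod W
  have hf : IsNewformOf W Dm.f := Dm.isNewformOf
  obtain ⟨ϖ, -, hϖ, -⟩ := Dm.exists_rat_mul_realPeriodRat_eq_plusPeriod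
  obtain ⟨κ, hκ, γ, hγ, hγ'⟩ := exists_isCyclotomic_isTopGenerator_isCyclotomicVariable_holds 2
  obtain ⟨DW⟩ := W.nonempty_selmerDualData_holds κ γ hγ
  obtain ⟨L, hLf⟩ := exists_isSplitMultPAdicLFunctionOf hsp hf
  obtain ⟨hX, g, hg, hι⟩ := hKint hmult hsp him hΔ Dm.f hf L hLf κ γ hκ hγ hγ' DW ϖ hϖ
  have hchar := charIdeal_eq_span_of_katoIntSplit_selmerPinch W hsp hlan hμan hκ hγ hγ' hf hLf DW hX
    hϖ hι hg hlow
  exact entireLFunction_one_ne_zero_of_finite_selmer_of_charIdeal_eq_span_split W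
    (twoAdicEulerCharRankZeroSplitMult_zero_of_greenberg W h41) hGS hmult hsp hκ hγ hγ' hf hLf DW hX
    hι hchar hfin

/-! ## §4 The UPPER HALF alone (item `MultUpperHalfAtTwo`) from T-KATO2-SPMULT — no certificate at all -/

/-- **`MissingUpperBoundAt W 2` at a SPLIT `2` for `E[2]` irreducible from T-KATO2-SPMULT ALONE
(PROVED modulo the displayed inputs; SHARP, no `λ`/`μ` certificate, no Selmer bound, no period datum).**
Rank `0` (`hr`), `Mult W 2`, split, `TwoAdicSurjective W`, `Δ < 0`; PRINT {A236 `h41`, `hmod`, `hGZK`};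
the tree's named fact `greenberg_stevens W 2` (`hGS`, discharging the `κ₁`-certificate by
`kappaOne_of_greenbergStevens`); MEMO {`hKint`}. `hKint` gives `X` torsion and `g ∈ char_Λ X` with
`ι(T·g) = ϖ·L`, and `upperBound_two_split_of_divisibilityRat` at `ϖ′ = ϖ`, `k = 0` gives
`ord₂ #Ш ≤ ord₂ #Ш_an`. This is the per-curve form of PROOF-KATO2SPLIT Cor. D(i) on the `Δ < 0` locus
(437 surjective split classes of record, 436 of rank `0`). The Tate datum and `log₂ q_E ≠ 0` are
discharged inside (Silverman V.5.3; Mahler–Manin / Barré-Sirieix et al.).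
[cite: GreenbergLNM1716, §4 pp. 112–113 (split l_v) and §3 p. 94]
[cite: MazurTateTeitelbaum1986Invent, §I.10, §I.14–15 and §II] [cite: Miller2011LMS, Def. 1.1]
[cite: SilvermanATAEC1994, Thm. V.5.3 (the Tate parameter)] -/
theorem missingUpperBoundAt_two_split_of_katoInt
    (h41 : thm41Analogue_charValue_rankZero_split_baseChange_anyPrime)
    (hGS : greenberg_stevens (W := W) (p := 2))
    (hmod : nonempty_modularParametrizationData)
    (hGZK : rank_eq_analyticRank_of_analyticRank_le_one)
    (hKint : KatoDivisibilityAtTwoSplitMultInt W)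
    (hr : W.analyticRank = 0) (hmult : Mult W 2) (hsp : W.HasSplitMultiplicativeReductionAtPrime 2)
    (him : TwoAdicSurjective W) (hΔ : W.Δ < 0) : MissingUpperBoundAt W 2 := by
  haveI : NeZero (W.conductorNorm ℤ) := ⟨(W.conductorNorm_pos_holds).ne'⟩
  obtain ⟨Dm⟩ := hmod W
  have hf : IsNewformOf W Dm.f := Dm.isNewformOf
  have hL : W.entireLFunction 1 ≠ 0 :=
    (W.analyticRank_eq_zero_iff_holds hf.hasEntireLFunction).mp hr
  obtain ⟨ϖ, hϖpos, hϖeq, -⟩ := Dm.exists_rat_mul_realPeriodRat_eq_plusPeriod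
  obtain ⟨κ, hκ, γ, hγ, hγ'⟩ := exists_isCyclotomic_isTopGenerator_isCyclotomicVariable_holds 2
  obtain ⟨D⟩ := W.nonempty_selmerDualData_holds κ γ hγ
  obtain ⟨L, hLf⟩ := exists_isSplitMultPAdicLFunctionOf hsp hf
  obtain ⟨Dq⟩ := (nonempty_tateParameterData_iff_holds (W := W) (p := 2)).mpr hsp
  have hlog : padicLog 2 Dq.q ≠ 0 := Dq.padicLog_q_ne_zero MahlerManinPadic_holds
  obtain ⟨hX, g, hg, hι⟩ := hKint hmult hsp him hΔ Dm.f hf L hLf κ γ hκ hγ hγ' D ϖ hϖeq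
  obtain ⟨q, hq, hle⟩ := upperBound_two_split_of_divisibilityRat W
    (twoAdicEulerCharRankZeroSplitMult_zero_of_greenberg W h41) hGZK hmult hsp hL hκ hγ hγ' hf Dq hlog
    (kappaOne_of_greenbergStevens W hGS hr hf hLf Dq) D ϖ hϖeq hϖpos.ne' 0 (by simp) ⟨hX, g, hg, hι⟩
  exact ⟨q, hq, by simpa using hle⟩

end Summit.BirchSwinnertonDyer.Rank1Residual.X5.O1

end
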